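import Summits.CriticalPhenomena.PercolationContinuityZ3.Theorems.PercNearOneGluingNoHeavyPcintMemoryTailLimit
import HarnessLib

/-!
# CriticalPhenomena/PercolationContinuityZ3 — Theorems/PercNearOneGluingNoHeavyPcintMemAutomatonPolygons.lean: the memory automaton has at least as many states as there are rooted polygons

Lane prim-pcint, STRUCTURE rule, law **C3** (prim-pcint-2 gen 13, pre-registered as predictions/P8-class-count-law.md, sha256
1f89ad55…): the number `N_d(τ)` of dangerous-set classes of the memory-`τ` automaton — the lane's COST of a memory rung — grows like
the number of rooted `τ`-step self-avoiding POLYGONS, `N_d(τ) ≍ A_d μ(ℤ^d)^τ τ^{−dν_d}`.  The LOWER half of that law has a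
one-line mechanism, proved here in the tree's vocabulary (`…PcintMemAutomaton`: `danger τ w` = the dangerous set of the word `w`,
`l1` = the `ℓ¹` norm, `memWords` / `sawWords`):

* `l1_sub_le`, `l1_wordPos_le` — `ℓ¹` bookkeeping (`‖w(k)‖₁ ≤ k`);
* `mem_danger_of_closing` — if a word of length `τ − 1` ends within `ℓ¹`-distance `1` of its start (it CLOSES to a rooted
  `τ`-step polygon), then EVERY visited site is still dangerous: the site of age `j` is at distance `≤ (τ−1−j) + 1 = τ − j`;
* `danger_injOn_closing` — hence `w ↦ danger τ w` is INJECTIVE on the closing words (the dangerous set lists every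
  `(w(τ−1−j) − w(τ−1), j)`, from which the word is read back step by step, `GMStep.stepVec_injective`);
* `card_closing_le_card_image_danger` — **the automaton states reached after `τ − 1` letters are at least as many as the
  closing self-avoiding words of length `τ − 1`** (= oriented rooted `τ`-step self-avoiding polygons, each opened at its root),
  stated with `memWords d τ (τ−1) = sawWords d (τ−1)` (`memWords_eq_sawWords`).

Consequently `N_d(τ) · |B_d| ≥ #{closing (τ−1)-step SAWs} = 2τ p_τ(ℤ^d)` (`p_τ` = polygons per site; `|B_d| = 2^d d!` the point
group the lane's class count quotients by) — the `μ^τ τ^{α−2} = μ^τ τ^{−dν}` floor of C3 (hyperscaling).  The UPPER half of C3 (that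
near-polygonal tails also dominate the count) is the conjecture; evidence and bands in P8.  All PROVED, no named fact; nothing
here is used by a certified `p_c` cell.  Written by prim-pcint-2 gen 13 (prover-prim-pcint-2-g13-0), 2026-08-23.
-/

noncomputable section

open Literature.Probability.LatticeModels Literature.Probability.Percolation
open Summit.CriticalPhenomena.PercolationContinuityZ3.Theorems.Pcint (IsMem l1 l1_neg l1_add_le l1_stepVec danger mem_danger)

namespace Summit.CriticalPhenomena.PercolationContinuityZ3.Theorems.Pcint.MemoryTail

variable {d : ℕ}

/-! ### `ℓ¹` bookkeeping -/

/-- `‖x − y‖₁ ≤ ‖x‖₁ + ‖y‖₁`. [folklore] -/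
theorem l1_sub_le (x y : Site d) : l1 (x - y) ≤ l1 x + l1 y := by
  simpa [sub_eq_add_neg, l1_neg] using l1_add_le x (-y)

/-- After `k ≤ n` unit steps a word is within `ℓ¹`-distance `k` of its start: `‖w(k)‖₁ ≤ k`. [folklore] -/
theorem l1_wordPos_le {n : ℕ} (w : Fin n → Fin d × Bool) : ∀ k, k ≤ n → l1 (wordPos w k) ≤ k := by
  intro k
  induction k with
  | zero => intro _; simp [l1]
  | succ k ih =>
    intro hk
    rw [wordPos_succ w (by omega : k < n)]
    exact (l1_add_le _ _).trans (by rw [l1_stepVec]; exact Nat.add_le_add_right (ih (by omega)) 1)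

/-! ### Closing words keep their whole history in the dangerous set -/

/-- For a word of length `τ − 1` ending within `ℓ¹`-distance `1` of its start, the site of every age `1 ≤ j ≤ τ − 1` is in the
dangerous set `danger τ w` (its distance from the tip is at most `(τ − 1 − j) + 1 = τ − j`). [folklore] -/
theorem mem_danger_of_closing {τ : ℕ} {w : Fin (τ - 1) → Fin d × Bool} (hend : l1 (wordPos w (τ - 1)) ≤ 1) {j : ℕ}
    (hj1 : 1 ≤ j) (hj : j ≤ τ - 1) : (wordPos w (τ - 1 - j) - wordPos w (τ - 1), j) ∈ danger τ w := by
  rw [mem_danger]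
  refine ⟨hj1, hj, hj, rfl, ?_⟩
  calc l1 (wordPos w (τ - 1 - j) - wordPos w (τ - 1)) ≤ l1 (wordPos w (τ - 1 - j)) + l1 (wordPos w (τ - 1)) := l1_sub_le _ _
    _ ≤ (τ - 1 - j) + 1 := Nat.add_le_add (l1_wordPos_le w _ (by omega)) hend
    _ = τ - j := by omega

/-- **Injectivity on closing words**: two words of length `τ − 1` that end within `ℓ¹`-distance `1` of their start and have the
same dangerous set are equal (the set records every `(w(τ−1−j) − w(τ−1), j)`; `j = τ − 1` recovers the endpoint, then every
position, then every step by `GMStep.stepVec_injective`). [folklore] -/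
theorem danger_injOn_closing (τ : ℕ) :
    Set.InjOn (danger (d := d) τ) {w : Fin (τ - 1) → Fin d × Bool | l1 (wordPos w (τ - 1)) ≤ 1} := by
  intro w hw w' hw' h
  simp only [Set.mem_setOf_eq] at hw hw'
  have key : ∀ j, 1 ≤ j → j ≤ τ - 1 →
      wordPos w (τ - 1 - j) - wordPos w (τ - 1) = wordPos w' (τ - 1 - j) - wordPos w' (τ - 1) := by
    intro j hj1 hj
    have hm := mem_danger_of_closing hw hj1 hj
    rw [h, mem_danger] at hm
    exact hm.2.2.2.1
  have hpos : ∀ k, k ≤ τ - 1 → wordPos w k = wordPos w' k := by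
    intro k hk
    rcases Nat.eq_zero_or_pos (τ - 1) with h0 | hpos
    · have : k = 0 := by omega
      subst this; simp
    have hE : wordPos w (τ - 1) = wordPos w' (τ - 1) := by
      have := key (τ - 1) (by omega) le_rfl
      simpa using this
    rcases Nat.eq_or_lt_of_le hk with rfl | hlt
    · exact hE
    have := key (τ - 1 - k) (by omega) (by omega)
    rw [show τ - 1 - (τ - 1 - k) = k by omega, hE] at this
    exact sub_left_injective this
  funext ⟨i, hi⟩
  have h0 := hpos i hi.le
  have h1 := hpos (i + 1) (by omega)
  rw [wordPos_succ w hi, wordPos_succ w' hi, h0] at h1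
  exact GMStep.stepVec_injective d (add_left_cancel h1)

/-! ### States ≥ rooted polygons -/

/-- **The memory-`τ` automaton has, after `τ − 1` letters, at least as many distinct dangerous sets as there are closing
self-avoiding words of length `τ − 1`** (words ending next to — or, vacuously for `τ ≤ 1`, at — the origin; for `τ ≥ 2` these
are the oriented rooted `τ`-step self-avoiding polygons opened at the root).  This is the rigorous floor `N_d(τ)·|B_d| ≥ 2τ·p_τ`
under the class-count law C3. [folklore] -/
theorem card_closing_le_card_image_danger (d τ : ℕ) :
    ((sawWords d (τ - 1)).filter fun w => l1 (wordPos w (τ - 1)) ≤ 1).card ≤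
      ((memWords d τ (τ - 1)).image (danger τ)).card := by
  classical
  refine Finset.card_le_card_of_injOn (danger τ) (fun w hw => ?_) ((danger_injOn_closing τ).mono fun w hw => ?_)
  · rw [Finset.mem_coe, Finset.mem_filter] at hw
    rw [Finset.mem_coe, Finset.mem_image]
    exact ⟨w, by rw [memWords_eq_sawWords (by omega : τ - 1 ≤ τ)]; exact hw.1, rfl⟩
  · rw [Finset.mem_coe, Finset.mem_filter] at hw
    exact hw.2

/-! ### The converse and the exact identity `FULL(τ) = closing words` (appended by gen 13 after the SIZEHIST census)

`closing_of_mem_danger`, `full_iff_closing`, `card_full_eq_card_closing`: the states reached after `τ − 1` letters that still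
contain a site of age `τ − 1` ('full' states — then every age is present) are in BIJECTION with the closing words, so
`#FULL(τ) = #closing = 2τ·p_τ(ℤ^d)` (oriented rooted polygons opened at the root).  Checked to the unit against the
square-lattice polygon counts by the lane's SIZEHIST census (gen13/README §3: top bin of the class histogram at `d = 2`,
`τ = 20 / 22 / 24 / 26` = `409 130 / 2 472 646 / 15 127 620 / 93 504 944 = 2τ·p_τ/8`, `p_τ` = A002931). -/

/-- Conversely, if the site of age `τ − 1` (the starting point) is still dangerous after `τ − 1` letters, the word closes:
its endpoint is within `ℓ¹`-distance `1` of its start. [folklore] -/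
theorem closing_of_mem_danger {τ : ℕ} (hτ : 2 ≤ τ) {w : Fin (τ - 1) → Fin d × Bool} {r : Site d}
    (h : (r, τ - 1) ∈ danger τ w) : l1 (wordPos w (τ - 1)) ≤ 1 := by
  rw [mem_danger] at h
  obtain ⟨-, -, -, hr, hl⟩ := h
  simp only [Nat.sub_self, wordPos_zero, zero_sub] at hr
  rw [hr, l1_neg] at hl
  have : τ - (τ - 1) = 1 := by omega
  rwa [this] at hl

/-- **FULL ⇔ CLOSING** (`τ ≥ 2`): a word of length `τ − 1` keeps its oldest site (age `τ − 1`) in the dangerous set iff it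
closes to a rooted `τ`-step polygon; by `mem_danger_of_closing` it then keeps ALL its sites.  This is the exact identity behind
the top bin of the lane's SIZEHIST census (gen 13: bond `d = 2`, `τ = 20..26`: top bin = `2τ·p_τ(ℤ²)/8` to the unit).
[folklore] -/
theorem full_iff_closing {τ : ℕ} (hτ : 2 ≤ τ) (w : Fin (τ - 1) → Fin d × Bool) :
    (∃ r : Site d, (r, τ - 1) ∈ danger τ w) ↔ l1 (wordPos w (τ - 1)) ≤ 1 := by
  constructor
  · rintro ⟨r, hr⟩
    exact closing_of_mem_danger hτ hr
  · intro h
    exact ⟨_, mem_danger_of_closing h (by omega) le_rfl⟩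

open Classical in
/-- **Exact count of the FULL states** (`τ ≥ 2`): among the dangerous sets reached after `τ − 1` letters of memory-`τ` words,
those containing a site of age `τ − 1` are in bijection with the closing self-avoiding words of length `τ − 1` (oriented rooted
`τ`-step self-avoiding polygons opened at the root): `#FULL = #closing`.  The lane's class count quotients further by the point
group `B_d` (free on closing words up to a vanishing fraction: `d = 3`, `τ = 12/14/16`: excess 1.2 % / 0.39 % / 0.13 %).
[folklore] -/
theorem card_full_eq_card_closing {τ : ℕ} (hτ : 2 ≤ τ) (d : ℕ) :
    (((memWords d τ (τ - 1)).image (danger τ)).filter fun S => ∃ r : Site d, (r, τ - 1) ∈ S).card =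
      ((sawWords d (τ - 1)).filter fun w => l1 (wordPos w (τ - 1)) ≤ 1).card := by
  symm
  refine Finset.card_bij (fun w _ => danger τ w) (fun w hw => ?_) (fun w hw w' hw' h => ?_) (fun S hS => ?_)
  · rw [Finset.mem_filter] at hw ⊢
    refine ⟨Finset.mem_image.2 ⟨w, by rw [memWords_eq_sawWords (by omega : τ - 1 ≤ τ)]; exact hw.1, rfl⟩, ?_⟩
    exact (full_iff_closing hτ w).2 hw.2
  · rw [Finset.mem_filter] at hw hw'
    exact danger_injOn_closing τ hw.2 hw'.2 h
  · rw [Finset.mem_filter, Finset.mem_image] at hS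
    obtain ⟨⟨w, hw, rfl⟩, hfull⟩ := hS
    refine ⟨w, ?_, rfl⟩
    rw [Finset.mem_filter]
    rw [memWords_eq_sawWords (by omega : τ - 1 ≤ τ)] at hw
    exact ⟨hw, (full_iff_closing hτ w).1 hfull⟩

end Summit.CriticalPhenomena.PercolationContinuityZ3.Theorems.Pcint.MemoryTail
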